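import Summits.ValiantsHypothesis.ValiantsHypothesis.Theorems.KPlusLogSqLawTropicalBParabolaCriterion
import Summits.ValiantsHypothesis.ValiantsHypothesis.Theorems.KPlusLogSqLawTropicalBTwoRowSharp
import Summits.ValiantsHypothesis.ValiantsHypothesis.Theorems.KPlusLogSqLawTropicalBTwoRowFamilyDefs

/-!
# Route «KPlusLogSqLaw», crux `TropicalB` (stmt-ValiantsHypothesis-19771) — the `m = 2` family, part 1: RANKS, SLOPES, VALUES
# (objects in `…TropicalBTwoRowFamilyDefs`; the census theorems are in `…TropicalBTwoRowFamily`)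

HONEST FRAMING.  Helper file (seat val-sym-trop-p4 (g2), cell `pub-symmetroid`, 2026-08-26).  A SMALL-FORMAT row (`m = 2`, every
`K ≥ 3`), far inside the crux's known regime; nothing on `TropicalB` in its window, `WeakLifting`, `MatrixDescartes`
(stmt-ValiantsHypothesis-18050) or VP ≠ VNP.  With `…TropicalBTwoRowSharp` (`T(2,K) ≤ 4K − 7`, p439570) this file makes the `m = 2`
tropical row EXACT for all `K ≥ 3`: `T(2, K) = 4K − 7` (the cell's records `4K − 7` were enumerated for `K ≤ 7` only,
HOME/DATA-CUT-0823.md l.556).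

THE FAMILY (`M = 4K²`, exponents `d_l = M·l + l²`).  The diagonal entries `(0,0)`, `(1,1)` carry all `K` classes, the off-diagonal
entries `(1,0)`, `(0,1)` carry the classes `1 … K−2` only.  Valuations put every intended chain term ON the parabola
`∑ v = slope²` and every other present term at depth `≥ 2M²` below it:
`v(0,0,a) = d_a²`, `v(1,1,b) = (d_{K−1} + d_b)² − d_{K−1}²`, `v(1,0,a) = (d_a + d_1)²`, `v(0,1,b) = (d_{K−2} + d_b)² − (d_{K−2} + d_1)²`.
The chain: identity terms along the HOOK `(a, 0)` (`a = 0…K−1`), `(K−1, b)` (`b = 1…K−1`) — total exponent ranks `0 … 2K−2` — and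
transposition terms along the INNER hook `(a, 1)` (`a = 1…K−2`), `(K−2, b)` (`b = 2…K−2`) — ranks `2 … 2K−4`; ordered by slope they
interleave as `A₀, A₁, B₂, A₂, B₃, A₃, …, B_{2K−4}, A_{2K−4}, A_{2K−3}, A_{2K−2}` (`4K − 6` terms), signs `(−1)^k` by the choice
`ε(0,0,0) = 1`, `ε(0,0,a) = −1 (a ≥ 1)`, `ε(1,1,K−2) = −1`, `ε(1,1,b) = 1` otherwise, `ε(1,0,·) = 1`, `ε(0,1,·) = −1` on `1…K−2`.
Dominance is the PARABOLA CRITERION (`isDominant_of_parabola`, p440741) with depth `D = 2M²` and gap bound `G = 6K²`.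

* `not_tropRootLawAt_two_sharp : 3 ≤ K → ¬ TropRootLawAt 2 K (4 * K - 8)`;
* `tropRootLawAt_two_iff : 3 ≤ K → (TropRootLawAt 2 K B ↔ 4 * K - 7 ≤ B)`.
[cell statement for `K ≤ 7`; the all-`K` family and its kernel proof are this seat's; folklore technique]
-/

set_option linter.dupNamespace false
set_option autoImplicit false

namespace Summit.ValiantsHypothesis.ValiantsHypothesis.Theorems.KPlusLogSqLaw

open Summit.ValiantsHypothesis.ValiantsHypothesis.Theorems.MatrixDescartes.Negative
open Summit.ValiantsHypothesis.ValiantsHypothesis.Theorems.LacunarySymmetroidMatrixDescartes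
open Summit.ValiantsHypothesis.ValiantsHypothesis.Theorems.LacunarySymmetroidMatrixDescartes.TropicalCensus
open Finset

namespace TwoRowFamily


/-- the two classes of chain term `k` add up to its rank. -/
theorem ca_add_cb (K k : ℕ) (hK : 3 ≤ K) : ca K k + cb K k = rk K k := by
  unfold ca cb rk; split_ifs <;> omega

/-- `ca ≤ K − 1`. -/
theorem ca_le (K k : ℕ) (hK : 3 ≤ K) : ca K k ≤ K - 1 := by have := ca_lt K k hK; omega

/-- `cb ≤ K − 1`. -/
theorem cb_le (K k : ℕ) (hK : 3 ≤ K) (hk : k ≤ 4 * K - 7) : cb K k ≤ K - 1 := by have := cb_lt K k hK hk; omega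

/-- consecutive chain terms: either the same rank (a transposition term followed by the identity term of that rank) or the next rank. -/
theorem rk_succ (K k : ℕ) (hK : 3 ≤ K) (_hk : k + 1 ≤ 4 * K - 7) :
    (rk K (k + 1) = rk K k ∧ (2 ≤ k ∧ k + 9 ≤ 4 * K ∧ k % 2 = 0) ∧ ¬ (2 ≤ k + 1 ∧ k + 1 + 9 ≤ 4 * K ∧ (k + 1) % 2 = 0)) ∨
      rk K (k + 1) = rk K k + 1 := by
  unfold rk
  split_ifs <;> first | contradiction | omega

/-- same-rank step: the classes are `(r−1, 1) → (r, 0)` (`r ≤ K−1`) or `(K−2, r+2−K) → (K−1, r+1−K)` (`r ≥ K`). -/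
theorem classes_sameRank (K k : ℕ) (hK : 3 ≤ K) (_hk : k + 1 ≤ 4 * K - 7) (h : rk K (k + 1) = rk K k)
    (hB : 2 ≤ k ∧ k + 9 ≤ 4 * K ∧ k % 2 = 0) (hA : ¬ (2 ≤ k + 1 ∧ k + 1 + 9 ≤ 4 * K ∧ (k + 1) % 2 = 0)) :
    (2 ≤ rk K k ∧ rk K k + 1 ≤ K ∧ ca K k + 1 = rk K k ∧ cb K k = 1 ∧ ca K (k + 1) = rk K k ∧ cb K (k + 1) = 0) ∨
    (K ≤ rk K k ∧ rk K k + 4 ≤ 2 * K ∧ ca K k = K - 2 ∧ cb K k + K = rk K k + 2 ∧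
      ca K (k + 1) = K - 1 ∧ cb K (k + 1) + K = rk K k + 1) := by
  unfold ca cb
  rw [if_pos hB, if_neg hA, h]
  unfold rk at *
  split_ifs at * <;> first | contradiction | omega

/-! ## 3. Slopes of the chain: strictly increasing with gaps `≤ 6K²` -/


/-- slope = `M·rank +` quadratic part. -/
theorem xN_eq (K k : ℕ) (hK : 3 ≤ K) : xN K k = M K * rk K k + ca K k ^ 2 + cb K k ^ 2 := by
  unfold xN dN
  have h := ca_add_cb K k hK
  rw [← h]; ring

/-- the quadratic part is at most `2(K−1)²`. -/
theorem quad_le (K k : ℕ) (hK : 3 ≤ K) (hk : k ≤ 4 * K - 7) : ca K k ^ 2 + cb K k ^ 2 ≤ 2 * (K - 1) ^ 2 := by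
  have h1 := ca_le K k hK
  have h2 := cb_le K k hK hk
  nlinarith

/-- the quadratic part never reaches the scale: `2(K−1)² < M`. -/
theorem two_sq_lt_M (K : ℕ) (hK : 3 ≤ K) : 2 * (K - 1) ^ 2 < M K := by
  unfold M
  have : (K - 1) ^ 2 ≤ K ^ 2 := Nat.pow_le_pow_left (Nat.sub_le K 1) 2
  have hK2 : 1 ≤ K ^ 2 := Nat.one_le_pow _ _ (by omega)
  omega

/-- `a² + 1 < (a+1)²` for `a ≥ 1`. -/
theorem sq_step_lt (a : ℕ) (ha : 1 ≤ a) : a ^ 2 + 1 < (a + 1) ^ 2 := by nlinarith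

/-- `(c+1)² + (t+1)² < (c+2)² + t²` when `t + 1 ≤ c` (here `c = K − 2`). -/
theorem sq_step_lt' (c t : ℕ) (h : t + 1 ≤ c) : c ^ 2 + (t + 1) ^ 2 < (c + 1) ^ 2 + t ^ 2 := by nlinarith

/-- the slopes strictly increase, by at most `6K²` per step. -/
theorem xN_step (K k : ℕ) (hK : 3 ≤ K) (hk : k + 1 ≤ 4 * K - 7) :
    xN K k < xN K (k + 1) ∧ xN K (k + 1) ≤ xN K k + 6 * K ^ 2 := by
  rw [xN_eq K k hK, xN_eq K (k + 1) hK]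
  have hq0 := quad_le K k hK (by omega)
  have hq1 := quad_le K (k + 1) hK hk
  have hM := two_sq_lt_M K hK
  have hMdef : M K = 4 * K ^ 2 := rfl
  have hK1 : (K - 1) ^ 2 ≤ K ^ 2 := Nat.pow_le_pow_left (Nat.sub_le K 1) 2
  rcases rk_succ K k hK hk with ⟨h, hB, hA⟩ | h
  · rw [h]
    rcases classes_sameRank K k hK hk h hB hA with ⟨h2, hrK, ha, hb, ha', hb'⟩ | ⟨hrK, hr2, ha, hb, ha', hb'⟩
    · have e : ca K (k + 1) = ca K k + 1 := by omega
      have hlt := sq_step_lt (ca K k) (by omega)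
      rw [hb] at hq0
      rw [hb', e] at hq1
      rw [hb, hb', e]
      simp only [one_pow, ne_eq, OfNat.ofNat_ne_zero, not_false_eq_true, zero_pow, add_zero] at hq0 hq1 ⊢
      constructor
      · omega
      · omega
    · have e1 : ca K (k + 1) = ca K k + 1 := by omega
      have e2 : cb K k = cb K (k + 1) + 1 := by omega
      have hlt := sq_step_lt' (ca K k) (cb K (k + 1)) (by omega)
      rw [e2] at hq0
      rw [e1] at hq1
      rw [e1, e2]
      constructor
      · omega
      · omega
  · rw [h, Nat.mul_succ]
    constructor
    · omega
    · omega


/-- the chain slopes strictly increase. -/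
theorem xZ_strictMono (K : ℕ) (hK : 3 ≤ K) : StrictMono (xZ K) := by
  rw [Fin.strictMono_iff_lt_succ]
  intro k
  unfold xZ
  have hk : (k : ℕ) + 1 ≤ 4 * K - 7 := by have := k.isLt; unfold nn at this; omega
  have := (xN_step K k hK hk).1
  simp only [Fin.val_succ, Fin.val_castSucc]
  exact_mod_cast this

/-- consecutive chain slopes differ by at most `6K²`. -/
theorem xZ_gap (K : ℕ) (hK : 3 ≤ K) (k : Fin (nn K)) : xZ K k.succ ≤ xZ K k.castSucc + 6 * (K : ℤ) ^ 2 := by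
  unfold xZ
  have hk : (k : ℕ) + 1 ≤ 4 * K - 7 := by have := k.isLt; unfold nn at this; omega
  have := (xN_step K k hK hk).2
  simp only [Fin.val_succ, Fin.val_castSucc]
  exact_mod_cast this

/-! ## 4. Chain terms: hook classes, values on the parabola, signs -/

/-- identity chain terms lie on the HOOK (`b = 0` or `a = K−1`); transposition chain terms on the INNER hook (`b = 1` or `a = K−2`),
inside the square `[1, K−2]²`. -/
theorem classes_hook (K k : ℕ) (hK : 3 ≤ K) (_hk : k ≤ 4 * K - 7) :
    (¬ (2 ≤ k ∧ k + 9 ≤ 4 * K ∧ k % 2 = 0) → (cb K k = 0 ∨ ca K k = K - 1)) ∧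
    ((2 ≤ k ∧ k + 9 ≤ 4 * K ∧ k % 2 = 0) →
      (cb K k = 1 ∨ ca K k = K - 2) ∧ 1 ≤ ca K k ∧ ca K k + 2 ≤ K ∧ 1 ≤ cb K k ∧ cb K k + 2 ≤ K) := by
  unfold ca cb rk
  constructor
  · intro hA; rw [if_neg hA, if_neg hA]; split_ifs <;> first | contradiction | omega
  · intro hB; rw [if_pos hB, if_pos hB]; split_ifs <;> first | contradiction | omega

/-- parity bookkeeping for the signs: the identity chain terms with even index are `k = 0` (classes `(0,0)`) and `k = 4K−8`
(classes `(K−1, K−2)`); the odd ones have `a ≥ 1` and `b ≠ K−2`. -/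
theorem classes_parity (K k : ℕ) (hK : 3 ≤ K) (_hk : k ≤ 4 * K - 7) (hA : ¬ (2 ≤ k ∧ k + 9 ≤ 4 * K ∧ k % 2 = 0)) :
    (k % 2 = 0 ∧ ((ca K k = 0 ∧ cb K k + 2 ≠ K) ∨ (ca K k ≠ 0 ∧ cb K k + 2 = K))) ∨
    (k % 2 = 1 ∧ ca K k ≠ 0 ∧ cb K k + 2 ≠ K) := by
  unfold ca cb rk
  rw [if_neg hA, if_neg hA]
  split_ifs <;> first | contradiction | omega

/-- `d_0 = 0`. -/
theorem dN_zero (K : ℕ) : dN K 0 = 0 := by simp [dN]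

/-- exponents grow by at least `M` per class. -/
theorem dN_add_M_le (K i j : ℕ) (hij : i < j) : dN K i + M K ≤ dN K j := by
  unfold dN
  have h1 : M K * (i + 1) ≤ M K * j := Nat.mul_le_mul_left _ hij
  have h2 : i ^ 2 ≤ j ^ 2 := Nat.pow_le_pow_left hij.le 2
  nlinarith

/-- value of an identity term on the hook: ON the parabola. -/
theorem val_id_hook (K a b : ℕ) (h : b = 0 ∨ a = K - 1) :
    vN K 0 0 a + vN K 1 1 b = (((dN K a : ℕ) : ℤ) + dN K b) ^ 2 := by
  unfold vN
  simp only [if_true, one_ne_zero, if_false]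
  rcases h with rfl | rfl
  · rw [dN_zero]; push_cast; ring
  · ring

/-- value of a transposition term on the inner hook: ON the parabola. -/
theorem val_swap_hook (K a b : ℕ) (h : b = 1 ∨ a = K - 2) :
    vN K 1 0 a + vN K 0 1 b = (((dN K a : ℕ) : ℤ) + dN K b) ^ 2 := by
  unfold vN
  simp only [if_true, one_ne_zero, if_false]
  rcases h with rfl | rfl
  · ring
  · ring

/-- value of an identity term OFF the hook: depth `≥ 2M²` below the parabola. -/
theorem val_id_off (K a b : ℕ) (hK : 3 ≤ K) (ha : a + 2 ≤ K) (hb : 1 ≤ b) :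
    (((dN K a : ℕ) : ℤ) + dN K b) ^ 2 + 2 * (M K : ℤ) ^ 2 ≤ vN K 0 0 a + vN K 1 1 b := by
  unfold vN
  simp only [if_true, one_ne_zero, if_false]
  have h1 : dN K a + M K ≤ dN K (K - 1) := dN_add_M_le K a (K - 1) (by omega)
  have h2 : dN K 0 + M K ≤ dN K b := dN_add_M_le K 0 b (by omega)
  rw [dN_zero] at h2
  have h1' : ((dN K a : ℕ) : ℤ) + M K ≤ dN K (K - 1) := by exact_mod_cast h1
  have h2' : ((M K : ℕ) : ℤ) ≤ dN K b := by exact_mod_cast (by simpa using h2)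
  have hM0 : (0 : ℤ) ≤ M K := by positivity
  nlinarith [mul_le_mul h1' h2' hM0 (by positivity)]

/-- value of a transposition term OFF the inner hook: depth `≥ 2M²` below the parabola. -/
theorem val_swap_off (K a b : ℕ) (hK : 3 ≤ K) (ha : a + 3 ≤ K) (hb : 2 ≤ b) :
    (((dN K a : ℕ) : ℤ) + dN K b) ^ 2 + 2 * (M K : ℤ) ^ 2 ≤ vN K 1 0 a + vN K 0 1 b := by
  unfold vN
  simp only [if_true, one_ne_zero, if_false]
  have h1 : dN K a + M K ≤ dN K (K - 2) := dN_add_M_le K a (K - 2) (by omega)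
  have h2 : dN K 1 + M K ≤ dN K b := dN_add_M_le K 1 b (by omega)
  have h1' : ((dN K a : ℕ) : ℤ) + M K ≤ dN K (K - 2) := by exact_mod_cast h1
  have h2' : ((dN K 1 : ℕ) : ℤ) + M K ≤ dN K b := by exact_mod_cast h2
  have hM0 : (0 : ℤ) ≤ M K := by positivity
  nlinarith [mul_le_mul (show ((M K : ℕ) : ℤ) ≤ dN K (K - 2) - dN K a by linarith)
    (show ((M K : ℕ) : ℤ) ≤ dN K b - dN K 1 by linarith) hM0 (by linarith)]

/-! ## 5. Indices of the hook terms (every hook / inner-hook term IS a chain term) -/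

/-- every identity term on the hook is a chain term: its index. -/
theorem exists_index_id (K a b : ℕ) (hK : 3 ≤ K) (ha : a < K) (hb : b < K) (h : b = 0 ∨ a = K - 1) :
    ∃ k, k ≤ 4 * K - 7 ∧ ¬ (2 ≤ k ∧ k + 9 ≤ 4 * K ∧ k % 2 = 0) ∧ ca K k = a ∧ cb K k = b := by
  by_cases hb0 : b = 0
  · subst hb0
    by_cases ha0 : a = 0
    · subst ha0
      refine ⟨0, by omega, by omega, ?_, ?_⟩
      · unfold ca rk; split_ifs <;> first | contradiction | omega
      · unfold cb rk; split_ifs <;> first | contradiction | omega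
    · refine ⟨2 * a - 1, by omega, by omega, ?_, ?_⟩
      · unfold ca rk; split_ifs <;> first | contradiction | omega
      · unfold cb rk; split_ifs <;> first | contradiction | omega
  · have haK : a = K - 1 := by omega
    subst haK
    by_cases h3 : b + 3 ≤ K
    · refine ⟨2 * (K - 1 + b) - 1, by omega, by omega, ?_, ?_⟩
      · unfold ca rk; split_ifs <;> first | contradiction | omega
      · unfold cb rk; split_ifs <;> first | contradiction | omega
    · by_cases h2 : b + 2 = K
      · refine ⟨4 * K - 8, by omega, by omega, ?_, ?_⟩
        · unfold ca rk; split_ifs <;> first | contradiction | omega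
        · unfold cb rk; split_ifs <;> first | contradiction | omega
      · refine ⟨4 * K - 7, by omega, by omega, ?_, ?_⟩
        · unfold ca rk; split_ifs <;> first | contradiction | omega
        · unfold cb rk; split_ifs <;> first | contradiction | omega

/-- every transposition term on the inner hook (classes in `[1, K−2]`) is a chain term: its index. -/
theorem exists_index_swap (K a b : ℕ) (hK : 3 ≤ K) (ha1 : 1 ≤ a) (ha2 : a + 2 ≤ K) (hb1 : 1 ≤ b) (hb2 : b + 2 ≤ K)
    (h : b = 1 ∨ a = K - 2) :
    ∃ k, k ≤ 4 * K - 7 ∧ (2 ≤ k ∧ k + 9 ≤ 4 * K ∧ k % 2 = 0) ∧ ca K k = a ∧ cb K k = b := by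
  by_cases hb0 : b = 1
  · subst hb0
    refine ⟨2 * a, by omega, by omega, ?_, ?_⟩
    · unfold ca rk; split_ifs <;> first | contradiction | omega
    · unfold cb rk; split_ifs <;> first | contradiction | omega
  · have haK : a = K - 2 := by omega
    subst haK
    refine ⟨2 * (K - 2 + b) - 2, by omega, by omega, ?_, ?_⟩
    · unfold ca rk; split_ifs <;> first | contradiction | omega
    · unfold cb rk; split_ifs <;> first | contradiction | omega

end TwoRowFamily

end Summit.ValiantsHypothesis.ValiantsHypothesis.Theorems.KPlusLogSqLaw
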